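import Literature.AlgebraicGeometry.HodgeTheory.AbelianVarietyCotangentHodgeHolds
import Mathlib.LinearAlgebra.Matrix.Dual
import Mathlib.LinearAlgebra.Charpoly.ToMatrix
import HarnessLib

/-!
# The characteristic polynomial of the cotangent map of an endomorphism is that of its analytic representation
# ([BirkenhakeLange2004] §1.2 Prop. 1.2.1 ∕ [LangeBirkenhake1992] §1.1.2 Cor. 1.1.7; [Kottwitz1992] §5 p. 390)

Layer `Literature/AlgebraicGeometry/HodgeTheory`, namespace `Literature.AlgebraicGeometry.HodgeTheory`.  ONE THEOREM + a linear-algebra lemma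
(no definition, no named fact, no instance, no notation, no `sorry`).  Cell `hodgecm-mathlib` (D-0151), FLOOR 0, P6 «MOD» (crux hLiu418 =
stmt-HodgeConjecture-24832, `--supports`), organ **E6-K** of the E6 road map (`F0/P6/A-p06/g32/ROADMAP-E6.v1`, A-p06 (g32)): the bridge by which the
KOTTWITZ clause of `stub_E6` («`charpoly (cotangentMap (fibreHom (ρ.i b) x)) = ∏_φ (X − φ b)^{m φ}`», `Cruxes/HLiu418/Lines/F0_P6a_PELWitnessE.lean`) is read
off the chart's (F2) `AuxChartGS.Mρ_kottwitz` (`Cb.charpoly = ∏ …` for the `ℂ`-linear avatar `Cb` of the lattice matrix `Mρ a b`): the endomorphism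
`y_b` of the fibre is BUILT (U6-b ∕ GAGA) with analytic representation `Cb`, so its cotangent map has the same characteristic polynomial.  HC_CM is
proved only modulo the printed citations until rung 0 closes; generic, count-neutral.

THE MATHEMATICS.  For a complex abelian variety `B` uniformised by an additive analytification `φ : ℂ^{dim B}∕Φ(ℤ^ι) → B(ℂ)` and an endomorphism
`g` with rational representation `A ∈ M(ι, ℤ)` (`φ ∘ ρ(A) = g(ℂ) ∘ φ`) and analytic representation `L` (`Φ ∘ A_ℝ = L ∘ Φ`), the differential at the
origin `Ψ₀ : T_e^*B ≅ Hom_ℂ(ℂ^{dim B}, ℂ)` (★ `HodgeTheory.AbelianVariety.exists_cotangentDifferential`) carries `T_e^*(g)` to pre-composition with `L` (★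
`cotangentDifferential_cotangentMap`, [LangeBirkenhake1992] Cor. 1.1.7).  Hence `T_e^*(g)` is conjugate to the dual map `L^∨`, whose characteristic
polynomial is that of `L` (transpose).  So `char(T_e^*(g)) = char(L)` — the algebraic cotangent action computes the ANALYTIC representation's
characteristic polynomial, which is where the Kottwitz signature is read in print ([Kottwitz1992] §5 p. 390: «the determinant condition … on Lie(A)»).

* (private) `charpoly_dualMap_eq` — `char(f^∨) = char(f)` (transpose).
* **`charpoly_cotangentMap_eq_charpoly_analyticRep`** — THE HEAD.

## References
* [LangeBirkenhake1992] H. Lange, Ch. Birkenhake, *Complex Abelian Varieties* (1992), §1.1.2 Prop. 1.1.6 (b), Cor. 1.1.7.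
* [BirkenhakeLange2004] 2nd ed., §1.2 Proposition 1.2.1 (analytic and rational representations).
* [Kottwitz1992] R. Kottwitz, *Points on some Shimura varieties over finite fields*, JAMS 5 (1992), §5 (p. 390).
-/

set_option autoImplicit false

noncomputable section

open CategoryTheory AlgebraicGeometry
open scoped Manifold
open Literature.Geometry.Kaehler (ComplexTorus)
open Literature.NumberTheory.Transcendental (IsAnalytification)
open Literature.AlgebraicGeometry.Motives (AbelianVariety ComplexPoints AlgPoints)

namespace Literature.AlgebraicGeometry.HodgeTheory

/-- **`char(f^∨) = char(f)`**: the dual map of an endomorphism of a finite free module has the same characteristic polynomial (its matrix in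
the dual basis is the transpose; Mathlib `LinearMap.toMatrix_transpose`, `Matrix.charpoly_transpose`; a private copy of the tree's
`Literature.LinearAlgebra` lemma `charpoly_dualMap`, to keep the import cone small). [cite: LangeBirkenhake1992, §1.1.2 Prop. 1.1.6 (b)] -/
private theorem charpoly_dualMap_eq {K : Type*} [Field K] {V : Type*} [AddCommGroup V] [Module K V] [FiniteDimensional K V] (f : V →ₗ[K] V) :
    f.dualMap.charpoly = f.charpoly := by
  classical
  let b := Module.Free.chooseBasis K V
  rw [← LinearMap.charpoly_toMatrix f b, ← LinearMap.charpoly_toMatrix f.dualMap b.dualBasis, LinearMap.dualMap_def,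
    LinearMap.toMatrix_transpose, Matrix.charpoly_transpose]

variable {B : AbelianVariety ℂ} {ι : Type} [Fintype ι]
  {Φ : (ι → ℝ) ≃L[ℝ] (Fin B.dim → ℂ)} {φ : ComplexTorus Φ → ComplexPoints B.X}

/-- **THE CHARACTERISTIC POLYNOMIAL OF THE COTANGENT MAP IS THAT OF THE ANALYTIC REPRESENTATION.**  Let `B` be a complex abelian variety with an
additive analytification `φ : ℂ^{dim B}∕Φ(ℤ^ι) → B(ℂ)` (★ (U) shape), `g : B → B` an endomorphism, `A ∈ M(ι, ℤ)` its rational representation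
(`φ ∘ ρ(A) = g(ℂ) ∘ φ`) and `L` its analytic representation (`Φ ∘ A_ℝ = L ∘ Φ`).  Then `char(T_e^*(g)) = char(L)`: the differential at the origin
(★ `AbelianVariety.exists_cotangentDifferential`) conjugates `T_e^*(g)` into `ℓ ↦ ℓ ∘ L` (★ `cotangentDifferential_cotangentMap`), i.e. into the dual map
of `L`, which has the characteristic polynomial of `L`.  In E6: `g = y_b` on a fibre, `L = Cb` of (F2) `Mρ_kottwitz`, so the Kottwitz clause of
`stub_E6` is `Cb.charpoly`. [cite: LangeBirkenhake1992, §1.1.2 Prop. 1.1.6 (b) and Cor. 1.1.7] [cite: Kottwitz1992, §5 (p. 390)] -/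
theorem charpoly_cotangentMap_eq_charpoly_analyticRep (hφ : IsAnalytification (Fin B.dim → ℂ) B.X B.dim φ)
    (hφadd : ∀ x y, φ (x + y) = φ x * φ y) (g : B ⟶ B) (A : Matrix ι ι ℤ) (L : (Fin B.dim → ℂ) →L[ℂ] (Fin B.dim → ℂ))
    (hAL : ∀ x : ι → ℝ, Φ ((A.map (Int.cast : ℤ → ℝ)).mulVec x) = L (Φ x))
    (hcomm : ∀ t, φ (ComplexTorus.mapMatrix Φ Φ A t) = AlgPoints.map g.hom.hom.hom (φ t)) :
    (Motives.AbelianVariety.cotangentMap B g).charpoly = (L : (Fin B.dim → ℂ) →ₗ[ℂ] (Fin B.dim → ℂ)).charpoly := by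
  classical
  obtain ⟨Ψ₀, hΨ₀⟩ := AbelianVariety.exists_cotangentDifferential hφ hφadd
  have h1 : ∀ c, Ψ₀ (Motives.AbelianVariety.cotangentMap B g c) = (Ψ₀ c).comp L := fun c =>
    cotangentDifferential_cotangentMap hφ hφadd Ψ₀.toLinearMap (fun U hU s hs => hΨ₀ U hU s hs) g A L hAL hcomm c
  -- pass to the algebraic dual: `e : (ℂ^g →L ℂ) ≃ₗ Dual ℂ ℂ^g`
  let e : ((Fin B.dim → ℂ) →L[ℂ] ℂ) ≃ₗ[ℂ] Module.Dual ℂ (Fin B.dim → ℂ) :=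
    (LinearMap.toContinuousLinearMap : ((Fin B.dim → ℂ) →ₗ[ℂ] ℂ) ≃ₗ[ℂ] ((Fin B.dim → ℂ) →L[ℂ] ℂ)).symm
  have hconj : (Ψ₀.trans e).conj (Motives.AbelianVariety.cotangentMap B g) =
      (L : (Fin B.dim → ℂ) →ₗ[ℂ] (Fin B.dim → ℂ)).dualMap := by
    apply LinearMap.ext
    intro ℓ
    rw [LinearEquiv.conj_apply, LinearMap.comp_apply, LinearMap.comp_apply, LinearEquiv.coe_coe, LinearEquiv.coe_coe,
      LinearEquiv.trans_apply, LinearEquiv.trans_symm, LinearEquiv.trans_apply, h1, LinearEquiv.apply_symm_apply,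
      LinearMap.dualMap_apply']
    apply LinearMap.ext
    intro w
    rfl
  rw [← LinearEquiv.charpoly_conj (Ψ₀.trans e) (Motives.AbelianVariety.cotangentMap B g), hconj, charpoly_dualMap_eq]

/-! ## §2 Any model space (ED. 2): the marking tori of ★ `SiegelAdelicMarking` are modelled on `ℂ^g`, not on `ℂ^{dim B}` -/

section AnyModel

variable {B : AbelianVariety ℂ} {ι : Type} [Fintype ι] {E : Type} [NormedAddCommGroup E] [NormedSpace ℂ E] [FiniteDimensional ℂ E]
  {Φ : (ι → ℝ) ≃L[ℝ] E} {φ : ComplexTorus Φ → ComplexPoints B.X}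

/-- The chain rule at the origin for an arbitrary model space `E` (★ `cotangentDifferential_cotangentMap` is the case `E = ℂ^{dim B}`; the
proof is the same, verbatim — a private generalisation for the head below). [cite: LangeBirkenhake1992, §1.1.2 Prop. 1.1.6 (b) and Cor. 1.1.7] -/
private theorem cotangentDifferential_cotangentMap_model (hφ : IsAnalytification E B.X B.dim φ)
    (hφadd : ∀ x y, φ (x + y) = φ x * φ y)
    (Ψ₀ : Motives.AbelianVariety.Cotangent B →ₗ[ℂ] ((E) →L[ℂ] ℂ))
    (hΨ₀ : ∀ (U : B.X.left.Opens) (hU : Motives.AbelianVariety.origin B ∈ U) (s : Γ(B.X.left, U))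
      (hs : B.X.left.presheaf.germ U (Motives.AbelianVariety.origin B) hU s ∈
        IsLocalRing.maximalIdeal (Motives.AbelianVariety.stalkOrigin B)),
      Ψ₀ (Motives.AbelianVariety.Cotangent.mk B ⟨_, hs⟩) =
        fderiv ℂ (fun z : E => AlgPoints.evalOrZero U s
            (φ ((extChartAt 𝓘(ℂ, E) (0 : ComplexTorus Φ)).symm z)))
          (extChartAt 𝓘(ℂ, E) (0 : ComplexTorus Φ) 0))
    (g : B ⟶ B) (A : Matrix ι ι ℤ) (L : (E) →L[ℂ] (E))
    (hAL : ∀ x : ι → ℝ, Φ ((A.map (Int.cast : ℤ → ℝ)).mulVec x) = L (Φ x))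
    (hcomm : ∀ t, φ (ComplexTorus.mapMatrix Φ Φ A t) = AlgPoints.map g.hom.hom.hom (φ t))
    (c : Motives.AbelianVariety.Cotangent B) :
    Ψ₀ (Motives.AbelianVariety.cotangentMap B g c) = (Ψ₀ c).comp L := by
  classical
  -- the preferred chart `χ` at `0`: its inverse is the covering map `π`, and `π (χ 0) = 0`
  have hχsymm : ∀ z, (extChartAt 𝓘(ℂ, E) (0 : ComplexTorus Φ)).symm z =
      ComplexTorus.cover Φ z :=
    fun z => congrFun (ComplexTorus.extChartAt_symm_eq_cover Φ (𝕜 := ℂ) 0) z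
  have hχ0 : ComplexTorus.cover Φ (extChartAt 𝓘(ℂ, E) (0 : ComplexTorus Φ) 0) = 0 :=
    ComplexTorus.cover_extChartAt_self Φ 0
  -- `φ 0 = e`: the torus origin goes to the origin of `B`
  have hφ0 : φ 0 = 1 := by
    have h00 := hφadd 0 0
    rw [add_zero] at h00
    exact mul_eq_left.mp h00.symm
  have hφ0pt : (φ 0).pt = Motives.AbelianVariety.origin B := by
    rw [hφ0]
    exact Motives.AbelianVariety.one_left_base (A := B) (IsLocalRing.closedPoint ℂ)
  -- (1) represent `c` by the germ of a section `s` on `U ∋ e`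
  obtain ⟨⟨a, ha⟩, rfl⟩ := Motives.AbelianVariety.Cotangent.mk_surjective (A := B) c
  obtain ⟨U, hU, s, rfl⟩ := B.X.left.presheaf.exists_germ_eq a
  -- (2) `T_e^*(g)` of that class is the class of the germ of `g^* s` on `g⁻¹ U`
  have hU' : Motives.AbelianVariety.origin B ∈ (Motives.AbelianVariety.Hom.toSchemeHom g) ⁻¹ᵁ U := by
    show (Motives.AbelianVariety.Hom.toSchemeHom g).base (Motives.AbelianVariety.origin B) ∈ U
    rw [Motives.AbelianVariety.toSchemeHom_origin]
    exact hU
  have hgerm : Motives.AbelianVariety.stalkMapEnd B g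
      (B.X.left.presheaf.germ U (Motives.AbelianVariety.origin B) hU s) =
      B.X.left.presheaf.germ ((Motives.AbelianVariety.Hom.toSchemeHom g) ⁻¹ᵁ U)
        (Motives.AbelianVariety.origin B) hU' ((Motives.AbelianVariety.Hom.toSchemeHom g).app U s) := by
    have h := congrArg (fun f => f.hom s) (Motives.AbelianVariety.germ_stalkMapEnd g U hU)
    simpa only [CommRingCat.hom_comp, RingHom.comp_apply] using h
  have hmem' : B.X.left.presheaf.germ ((Motives.AbelianVariety.Hom.toSchemeHom g) ⁻¹ᵁ U)
      (Motives.AbelianVariety.origin B) hU' ((Motives.AbelianVariety.Hom.toSchemeHom g).app U s) ∈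
      IsLocalRing.maximalIdeal (Motives.AbelianVariety.stalkOrigin B) :=
    hgerm ▸ Motives.AbelianVariety.stalkMapEnd_mem g ha
  have hcot : Motives.AbelianVariety.cotangentMap B g (Motives.AbelianVariety.Cotangent.mk B ⟨_, ha⟩) =
      Motives.AbelianVariety.Cotangent.mk B ⟨_, hmem'⟩ := by
    rw [Motives.AbelianVariety.cotangentMap_mk]
    congr 1
    exact Subtype.ext hgerm
  rw [hcot, hΨ₀ _ hU' _ hmem', hΨ₀ U hU s ha]
  -- (3) both sides are differentials of `G := s ∘ φ ∘ π`
  set G : (E) → ℂ := fun w =>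
    AlgPoints.evalOrZero U s (φ (ComplexTorus.cover Φ w)) with hG
  have hfun₂ : (fun z : E => AlgPoints.evalOrZero U s
      (φ ((extChartAt 𝓘(ℂ, E) (0 : ComplexTorus Φ)).symm z))) = G := by
    funext z
    simp only [hG, hχsymm]
  have hfun₁ : (fun z : E => AlgPoints.evalOrZero
      ((Motives.AbelianVariety.Hom.toSchemeHom g) ⁻¹ᵁ U)
      ((Motives.AbelianVariety.Hom.toSchemeHom g).app U s)
      (φ ((extChartAt 𝓘(ℂ, E) (0 : ComplexTorus Φ)).symm z))) = G ∘ L := by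
    funext z
    simp only [hG, Function.comp_apply, hχsymm]
    rw [ComplexTorus.cover_apply_eq_mapMatrix_cover hAL z, hcomm,
      AlgPoints.evalOrZero_map (g.hom.hom.hom) U s]
  rw [hfun₁, hfun₂]
  -- (4) `χ 0` and `L (χ 0)` are lattice vectors; `G` is lattice periodic
  obtain ⟨n, hn⟩ := (ComplexTorus.cover_eq_zero_iff Φ _).1 hχ0
  have hLn : L (ComplexTorus.latticeVec Φ n) = ComplexTorus.latticeVec Φ (A.mulVec n) := by
    rw [ComplexTorus.latticeVec, ComplexTorus.latticeVec, ← hAL]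
    congr 1
    funext i
    have h := RingHom.map_mulVec (Int.castRingHom ℝ) A n i
    simp only [Int.coe_castRingHom] at h
    rw [h]
    rfl
  have hper : ∀ m : ι → ℤ, fderiv ℂ G (ComplexTorus.latticeVec Φ m) = fderiv ℂ G 0 := by
    intro m
    have hGm : G = fun w => G (w + ComplexTorus.latticeVec Φ m) := by
      funext w
      simp only [hG, ComplexTorus.cover_add_latticeVec]
    conv_rhs => rw [hGm]
    rw [fderiv_comp_add_right, zero_add]
  -- (5) `G` is differentiable at the lattice vector `L (χ 0)`
  have hdiff : DifferentiableAt ℂ G (L (extChartAt 𝓘(ℂ, E) (0 : ComplexTorus Φ) 0)) := by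
    rw [hn, hLn]
    have h0 : ComplexTorus.cover Φ (ComplexTorus.latticeVec Φ (A.mulVec n)) = 0 :=
      ComplexTorus.cover_latticeVec Φ _
    have h1 : MDifferentiableAt 𝓘(ℂ, E) 𝓘(ℂ, ℂ)
        (fun m => AlgPoints.evalOrZero U s (φ m))
        (ComplexTorus.cover Φ (ComplexTorus.latticeVec Φ (A.mulVec n))) := by
      rw [h0]
      refine (IsAnalytification.mdifferentiableOn_evalOrZero_opens_holds hφ U s).mdifferentiableAt
        ((hφ.isOpen_preimage U).mem_nhds ?_)
      show (φ 0).pt ∈ U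
      rw [hφ0pt]
      exact hU
    have h2 : MDifferentiableAt 𝓘(ℂ, E) 𝓘(ℂ, E) (ComplexTorus.cover Φ)
        (ComplexTorus.latticeVec Φ (A.mulVec n)) :=
      ComplexTorus.mdifferentiable_cover Φ _
    exact mdifferentiableAt_iff_differentiableAt.1 (h1.comp _ h2)
  -- (6) chain rule
  rw [fderiv_comp _ hdiff L.differentiableAt, ContinuousLinearMap.fderiv, hn, hLn, hper, hper]

/-- **`char(T_e^*(g)) = char(ρ_a(g))` FOR AN ANALYTIFICATION MODELLED ON ANY `E`** (e.g. the `ℂ^g`-modelled marking tori of ★ `SiegelAdelicMarking`,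
where `g = dim B` only propositionally): same statement and proof as §1's head, through the any-model differential at the origin (★
`AbelianVariety.exists_cotangentDifferential_of_isAnalytification`) and the private any-model chain rule above.
[cite: LangeBirkenhake1992, §1.1.2 Prop. 1.1.6 (b) and Cor. 1.1.7] [cite: Kottwitz1992, §5 (p. 390)] -/
theorem charpoly_cotangentMap_eq_charpoly_analyticRep_of_model (hφ : IsAnalytification E B.X B.dim φ)
    (hφadd : ∀ x y, φ (x + y) = φ x * φ y) (g : B ⟶ B) (A : Matrix ι ι ℤ) (L : E →L[ℂ] E)
    (hAL : ∀ x : ι → ℝ, Φ ((A.map (Int.cast : ℤ → ℝ)).mulVec x) = L (Φ x))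
    (hcomm : ∀ t, φ (ComplexTorus.mapMatrix Φ Φ A t) = AlgPoints.map g.hom.hom.hom (φ t)) :
    (Motives.AbelianVariety.cotangentMap B g).charpoly = (L : E →ₗ[ℂ] E).charpoly := by
  classical
  have hφ0 : φ 0 = 1 := by
    have h00 := hφadd 0 0
    rw [add_zero] at h00
    exact mul_eq_left.mp h00.symm
  have hφ0pt : (φ 0).pt = Motives.AbelianVariety.origin B := by
    rw [hφ0]
    exact Motives.AbelianVariety.one_left_base (A := B) (IsLocalRing.closedPoint ℂ)
  obtain ⟨Ψ₀, hΨ₀⟩ := AbelianVariety.exists_cotangentDifferential_of_isAnalytification hφ 0 hφ0pt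
  have h1 : ∀ c, Ψ₀ (Motives.AbelianVariety.cotangentMap B g c) = (Ψ₀ c).comp L := fun c =>
    cotangentDifferential_cotangentMap_model hφ hφadd Ψ₀.toLinearMap (fun U hU s hs => hΨ₀ U hU s hs) g A L hAL hcomm c
  let e : (E →L[ℂ] ℂ) ≃ₗ[ℂ] Module.Dual ℂ E :=
    (LinearMap.toContinuousLinearMap : (E →ₗ[ℂ] ℂ) ≃ₗ[ℂ] (E →L[ℂ] ℂ)).symm
  have hconj : (Ψ₀.trans e).conj (Motives.AbelianVariety.cotangentMap B g) = (L : E →ₗ[ℂ] E).dualMap := by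
    apply LinearMap.ext
    intro ℓ
    rw [LinearEquiv.conj_apply, LinearMap.comp_apply, LinearMap.comp_apply, LinearEquiv.coe_coe, LinearEquiv.coe_coe,
      LinearEquiv.trans_apply, LinearEquiv.trans_symm, LinearEquiv.trans_apply, h1, LinearEquiv.apply_symm_apply,
      LinearMap.dualMap_apply']
    apply LinearMap.ext
    intro w
    rfl
  rw [← LinearEquiv.charpoly_conj (Ψ₀.trans e) (Motives.AbelianVariety.cotangentMap B g), hconj, charpoly_dualMap_eq]

end AnyModel

end Literature.AlgebraicGeometry.HodgeTheory

end
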